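/-
Origin: expansion seat `prover-pub-hodgecm-mc-sinst-1-g5-0`, handover #1222 2026-08-20T10:16Z md5 d5372ef45cf8 (176 l., 5 decls) NEW additive drop-alone leaf over RUN-47 #1221 + RUN-36 `HypCensus/ArchDatumCM`; (VT) at the CM pin: `exists_archFactor_eq_smul_cmArchWeilRep_compCLE` (frame / hT / hfac discharged; remaining hyps = (STRIP) + Levi shape of m = toSp(a(u₁)b(u₂))⁻¹·h₀); NAME LIST: HodgeCM.Model.ArchLevi.exists_archFactor_eq_smul_cmArchWeilRep_compCLE · HodgeCM.Model.ArchLevi.exists_archFactor_eq_smul_cmArchWeilRep_compCLE_ne_zero · HodgeCM.Model.ArchLevi.proj_pairSplitting_archProdHom (`HOME/mc/pub-hodgecm-mc-sinst-1-g5/stage/HodgeCM/Model/ArchLeviFactorizationCM.lean`, md5 d5372ef45cf8, 176 lines);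
landed by the second packager p2 gen 6 (p2-g6) in gate run 48 as `HodgeCM/Model/ArchLeviFactorizationCM.lean` (verbatim).
-/
/-
Origin: speedrun cell pub-hodgecm, MODEL-CONSTRUCTION sub-cell, lineage mc-sinst-1 (S-instance constructor, BINDER-OWNERS row 5 `S` / row 6 `μ`: (J-μ) slots 2/3,
(VT) at the CM pin), seat prover-pub-hodgecm-mc-sinst-1-g5-0 (gen 5), 2026-08-20.
Target in PKG: `HodgeCM/Model/ArchLeviFactorizationCM.lean` (NEW additive leaf; imports sinst RUN-47 #1221 `Model/ArchLeviFactorization` + binder-2's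
RUN-36 `Model/HypCensus/ArchDatumCM`; rowdep: none beyond PKG of record after RUN 47).
KERNEL only: 0 records / `def … : Prop` / cites-as-hypotheses, 0 proof holes; intended closure {propext, Classical.choice, Quot.sound}.
-/
import Summits.HodgeConjecture.HodgeCM.Model.ArchLeviFactorization
import Summits.HodgeConjecture.HodgeCM.Model.HypCensus.ArchDatumCM

/-!
# (VT) at the CM pin: the archimedean factor of the conjugated see-saw element versus `cmArchWeilRep hGR u ∘ (Φ ↦ Φ ∘ P⁻¹)`

#1221 `ArchLevi.exists_archFactor_eq_smul_archRepMp_compCLE` specialised to the CM pin of binder-2's `HypCensus.ArchDatumCM`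
(`F = L⁺`, `E = L`, `J_V = diag dV`, `J_W = diag dW`, Gram `adelicGram e (realDiagonal dV) (realDiagonal dW)`, splitting of record
`cmSplittingOf … hGR`, archimedean Weil representation `cmArchWeilRep … hGR`), with the three nuisance parameters of #1221 DISCHARGED here:
the real frame `e` (any — `Module.finBasis`), `hT : IsUnit (archMat T)` (`isUnit_det_adelicGram`), and the factorisation `hfac`
(`m := (toSp (a(u₁) · b(u₂)))⁻¹ * h₀`, `proj_cmSplittingOf`).  What is left to the caller is exactly:
(STRIP) — an implementer `M` of `h₀` with tensor decomposition `(A, M_f)`; and the LEVI SHAPE `hP`/`hQ` of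
`m = (toSp (adelicInl (archToAdelic u.1) * adelicInr (archToAdelic u.2)))⁻¹ * h₀` — the literal subject of
`ArchActQuadraticPlaces.placeVec_archAct_toSp_inl_mul_inr`.

* **`exists_archFactor_eq_smul_cmArchWeilRep_compCLE`**: `∃ c : ℂ, ∀ Φ, A Φ = c • cmArchWeilRep … hGR u (compCLE P Φ)`;
* `…_ne_zero`: `c ≠ 0` from one `A Φ₀ ≠ 0`;
* `archPairElt u = a(x_∞)·b(y_∞)`, `archPairSp u = toSp (archPairElt u)`, `proj_pairSplitting_archProdHom` (the splitting of record lies over it).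

(J-μ) slots 2/3: `u := (1, conjTransportK c.D)`, `h₀ := seesawElement …` (= `proj cmConjSeesawMp`, period-1 (STRIP) §2),
`P := (conjFrameTransport V c.D).symm` (theta-3 (K9)/(K11)), `Φ := Φ_{X'}` — then `compCLE P Φ_{X'} = Φ_X` and the conclusion is #1218's `hY`.
Nothing here is a claim of PerL/QW8; nothing is cited as a fact.

References: [Folland1989] G. B. Folland, *Harmonic Analysis in Phase Space*, Princeton UP 1989, Prop. (1.43), Prop. (1.50), (4.24).
-/

set_option autoImplicit false

noncomputable section

open scoped Matrix SchwartzMap TensorProduct Classical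
open NumberField IsDedekindDomain
open Literature.NumberTheory.Automorphic Literature.RepresentationTheory.HeisenbergGroup
open Literature.Analysis.SegalBargmann Literature.NumberTheory.Weil1964
open Literature.NumberTheory.GelbartRogawski1991 Literature.NumberTheory.GelbartRogawski1991.UnitaryDualPair
open HodgeCM.Model.HypCensus

namespace HodgeCM.Model.ArchLevi

section CMPin

variable (L : Type) [Field L] [NumberField L] [IsCMField L] {N M n : ℕ} (e : Fin N × Fin M ≃ Fin n)
variable (dV : Fin N → L) (hdV : ∀ i, IsCMField.complexConj L (dV i) = dV i) (hdV0 : ∀ i, dV i ≠ 0)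
variable (dW : Fin M → L) (hdW : ∀ i, IsCMField.complexConj L (dW i) = dW i) (hdW0 : ∀ i, dW i ≠ 0)
variable (hGR : (cmSplittingDatum L e dV hdV hdV0 dW hdW hdW0).CompatibleSplitting)

/-- The element of `G₁(𝔸_{L⁺})` under an archimedean pair `u = (x_∞, y_∞)`: `a(x_∞) · b(y_∞)`. [folklore] -/
abbrev archPairElt
    (u : UnitaryGroup.arch (↥(maximalRealSubfield L)) L (IsCMField.complexConj L) N (Matrix.diagonal dV) ×
      UnitaryGroup.arch (↥(maximalRealSubfield L)) L (IsCMField.complexConj L) M (Matrix.diagonal dW)) :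
    UnitaryGroup.adelicPair (↥(maximalRealSubfield L)) L (IsCMField.complexConj L) N M (Matrix.diagonal dV)
      (Matrix.diagonal dW) :=
  UnitaryGroup.adelicInl (↥(maximalRealSubfield L)) L (IsCMField.complexConj L) N M (Matrix.diagonal dV) (Matrix.diagonal dW)
      (UnitaryGroup.archToAdelic (↥(maximalRealSubfield L)) L (IsCMField.complexConj L) N (Matrix.diagonal dV) u.1) *
    UnitaryGroup.adelicInr (↥(maximalRealSubfield L)) L (IsCMField.complexConj L) N M (Matrix.diagonal dV) (Matrix.diagonal dW)
      (UnitaryGroup.archToAdelic (↥(maximalRealSubfield L)) L (IsCMField.complexConj L) M (Matrix.diagonal dW) u.2)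

/-- The symplectic image `toSp (a(x_∞) · b(y_∞)) ∈ Sp(𝕎_𝔸)` of an archimedean pair. [folklore] -/
abbrev archPairSp
    (u : UnitaryGroup.arch (↥(maximalRealSubfield L)) L (IsCMField.complexConj L) N (Matrix.diagonal dV) ×
      UnitaryGroup.arch (↥(maximalRealSubfield L)) L (IsCMField.complexConj L) M (Matrix.diagonal dW)) :
    symplecticGroup (polar (adelicForm (↥(maximalRealSubfield L)) (Fin n)
      (adelicGram (↥(maximalRealSubfield L)) e (realDiagonal L dV hdV) (realDiagonal L dW hdW)))) :=
  toSp (↥(maximalRealSubfield L)) L (IsCMField.complexConj L) N M e (Matrix.diagonal dV) (Matrix.diagonal dW)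
    (complexConj_imagUnit L) (imagUnit_ne_zero L) (imagUnit_mul_self L)
    (realDiagonal_isSymm L dV hdV) (realDiagonal_isSymm L dW hdW)
    (realDiagonal_map L dV hdV).symm (realDiagonal_map L dW hdW).symm (archPairElt L dV dW u)

/-- `proj (s (a(x_∞)·b(y_∞))) = toSp (a(x_∞)·b(y_∞))` for the splitting of record (`proj_cmSplittingOf`). [folklore] -/
theorem proj_pairSplitting_archProdHom
    (u : UnitaryGroup.arch (↥(maximalRealSubfield L)) L (IsCMField.complexConj L) N (Matrix.diagonal dV) ×
      UnitaryGroup.arch (↥(maximalRealSubfield L)) L (IsCMField.complexConj L) M (Matrix.diagonal dW)) :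
    adelicMpCont.proj (↥(maximalRealSubfield L)) (Fin n)
        (adelicGram (↥(maximalRealSubfield L)) e (realDiagonal L dV hdV) (realDiagonal L dW hdW))
        (((pairSplitting (↥(maximalRealSubfield L)) L (IsCMField.complexConj L) N M e (Matrix.diagonal dV)
            (Matrix.diagonal dW) (cmSplittingOf L e dV hdV hdV0 dW hdW hdW0 hGR)).comp
          (archProdHom (↥(maximalRealSubfield L)) L (IsCMField.complexConj L) N M (Matrix.diagonal dV)
            (Matrix.diagonal dW))) u) =
      archPairSp L e dV hdV dW hdW u :=
  proj_cmSplittingOf L e dV hdV hdV0 dW hdW hdW0 hGR _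

/-- **(VT) AT THE CM PIN, modulo (STRIP) and the Levi shape of `m = toSp(a(x_∞)b(y_∞))⁻¹ · h₀`**:
`∃ c, ∀ Φ, A Φ = c • cmArchWeilRep hGR u (Φ ∘ P⁻¹)`. [cite: Folland1989, Prop. (1.43), Prop. (1.50), (4.24)] -/
theorem exists_archFactor_eq_smul_cmArchWeilRep_compCLE
    (u : UnitaryGroup.arch (↥(maximalRealSubfield L)) L (IsCMField.complexConj L) N (Matrix.diagonal dV) ×
      UnitaryGroup.arch (↥(maximalRealSubfield L)) L (IsCMField.complexConj L) M (Matrix.diagonal dW))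
    (h₀ : symplecticGroup (polar (adelicForm (↥(maximalRealSubfield L)) (Fin n)
      (adelicGram (↥(maximalRealSubfield L)) e (realDiagonal L dV hdV) (realDiagonal L dW hdW)))))
    (Mω : piSchwartzBruhat (↥(maximalRealSubfield L)) (Fin n) ≃ₗ[ℂ] piSchwartzBruhat (↥(maximalRealSubfield L)) (Fin n))
    (hM : Implements (adelicSchrodinger (↥(maximalRealSubfield L)) (Fin n)
        (adelicGram (↥(maximalRealSubfield L)) e (realDiagonal L dV hdV) (realDiagonal L dW hdW)))
      (ofSymplectic (polar (adelicForm (↥(maximalRealSubfield L)) (Fin n)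
        (adelicGram (↥(maximalRealSubfield L)) e (realDiagonal L dV hdV) (realDiagonal L dW hdW)))) h₀) Mω)
    (A : 𝓢((Fin n → mixedEmbedding.mixedSpace (↥(maximalRealSubfield L))), ℂ) →L[ℂ]
      𝓢((Fin n → mixedEmbedding.mixedSpace (↥(maximalRealSubfield L))), ℂ))
    (Mf : FinSB (↥(maximalRealSubfield L)) (Fin n) →ₗ[ℂ] FinSB (↥(maximalRealSubfield L)) (Fin n))
    (hAM : ∀ (Φ : 𝓢((Fin n → mixedEmbedding.mixedSpace (↥(maximalRealSubfield L))), ℂ))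
      (f : FinSB (↥(maximalRealSubfield L)) (Fin n)),
      Mω (piSchwartzBruhatEquiv (↥(maximalRealSubfield L)) (Fin n) (Φ ⊗ₜ f)) =
        piSchwartzBruhatEquiv (↥(maximalRealSubfield L)) (Fin n) (A Φ ⊗ₜ Mf f))
    {f₀ : FinSB (↥(maximalRealSubfield L)) (Fin n)} (hf₀ : Mf f₀ ≠ 0)
    (P : (Fin n → mixedEmbedding.mixedSpace (↥(maximalRealSubfield L))) ≃L[ℝ]
      (Fin n → mixedEmbedding.mixedSpace (↥(maximalRealSubfield L))))
    (Q : (Fin n → mixedEmbedding.mixedSpace (↥(maximalRealSubfield L))) →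
      (Fin n → mixedEmbedding.mixedSpace (↥(maximalRealSubfield L))))
    (hP : ∀ a w, (archAct (adelicGram (↥(maximalRealSubfield L)) e (realDiagonal L dV hdV) (realDiagonal L dW hdW))
      ((archPairSp L e dV hdV dW hdW u)⁻¹ * h₀) (a, w)).1 = P a)
    (hQ : ∀ a w, (archAct (adelicGram (↥(maximalRealSubfield L)) e (realDiagonal L dV hdV) (realDiagonal L dW hdW))
      ((archPairSp L e dV hdV dW hdW u)⁻¹ * h₀) (a, w)).2 = Q w) :
    ∃ c : ℂ, ∀ Φ : 𝓢((Fin n → mixedEmbedding.mixedSpace (↥(maximalRealSubfield L))), ℂ),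
      A Φ = c • cmArchWeilRep L e dV hdV hdV0 dW hdW hdW0 hGR u (compCLE P Φ) := by
  -- a real frame of the archimedean carrier (any will do) and the invertibility of the archimedean Gram
  let eFr : (Fin n → mixedEmbedding.mixedSpace (↥(maximalRealSubfield L))) ≃L[ℝ]
      (Fin (Module.finrank ℝ (Fin n → mixedEmbedding.mixedSpace (↥(maximalRealSubfield L)))) → ℝ) :=
    (Module.finBasis ℝ (Fin n → mixedEmbedding.mixedSpace (↥(maximalRealSubfield L)))).equivFun.toContinuousLinearEquiv
  have hT : IsUnit (archMat (↥(maximalRealSubfield L)) (Fin n)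
      (adelicGram (↥(maximalRealSubfield L)) e (realDiagonal L dV hdV) (realDiagonal L dW hdW))) :=
    isUnit_archMat_of_isUnit _ ((Matrix.isUnit_iff_isUnit_det _).2
      (isUnit_det_adelicGram (↥(maximalRealSubfield L)) e (isUnit_det_realDiagonal L dV hdV hdV0)
        (isUnit_det_realDiagonal L dW hdW hdW0)))
  have hfac : h₀ = adelicMpCont.proj (↥(maximalRealSubfield L)) (Fin n)
        (adelicGram (↥(maximalRealSubfield L)) e (realDiagonal L dV hdV) (realDiagonal L dW hdW))
        (((pairSplitting (↥(maximalRealSubfield L)) L (IsCMField.complexConj L) N M e (Matrix.diagonal dV)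
            (Matrix.diagonal dW) (cmSplittingOf L e dV hdV hdV0 dW hdW hdW0 hGR)).comp
          (archProdHom (↥(maximalRealSubfield L)) L (IsCMField.complexConj L) N M (Matrix.diagonal dV)
            (Matrix.diagonal dW))) u) * ((archPairSp L e dV hdV dW hdW u)⁻¹ * h₀) := by
    rw [proj_pairSplitting_archProdHom, mul_inv_cancel_left]
  exact exists_archFactor_eq_smul_archRepMp_compCLE _ _ _ eFr hT h₀ Mω hM A Mf hAM hf₀ u _ P Q hP hQ hfac

/-- … with `c ≠ 0` as soon as `A Φ₀ ≠ 0` for one `Φ₀`. [cite: Folland1989, Prop. (1.50)] -/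
theorem exists_archFactor_eq_smul_cmArchWeilRep_compCLE_ne_zero
    (u : UnitaryGroup.arch (↥(maximalRealSubfield L)) L (IsCMField.complexConj L) N (Matrix.diagonal dV) ×
      UnitaryGroup.arch (↥(maximalRealSubfield L)) L (IsCMField.complexConj L) M (Matrix.diagonal dW))
    (h₀ : symplecticGroup (polar (adelicForm (↥(maximalRealSubfield L)) (Fin n)
      (adelicGram (↥(maximalRealSubfield L)) e (realDiagonal L dV hdV) (realDiagonal L dW hdW)))))
    (Mω : piSchwartzBruhat (↥(maximalRealSubfield L)) (Fin n) ≃ₗ[ℂ] piSchwartzBruhat (↥(maximalRealSubfield L)) (Fin n))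
    (hM : Implements (adelicSchrodinger (↥(maximalRealSubfield L)) (Fin n)
        (adelicGram (↥(maximalRealSubfield L)) e (realDiagonal L dV hdV) (realDiagonal L dW hdW)))
      (ofSymplectic (polar (adelicForm (↥(maximalRealSubfield L)) (Fin n)
        (adelicGram (↥(maximalRealSubfield L)) e (realDiagonal L dV hdV) (realDiagonal L dW hdW)))) h₀) Mω)
    (A : 𝓢((Fin n → mixedEmbedding.mixedSpace (↥(maximalRealSubfield L))), ℂ) →L[ℂ]
      𝓢((Fin n → mixedEmbedding.mixedSpace (↥(maximalRealSubfield L))), ℂ))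
    (Mf : FinSB (↥(maximalRealSubfield L)) (Fin n) →ₗ[ℂ] FinSB (↥(maximalRealSubfield L)) (Fin n))
    (hAM : ∀ (Φ : 𝓢((Fin n → mixedEmbedding.mixedSpace (↥(maximalRealSubfield L))), ℂ))
      (f : FinSB (↥(maximalRealSubfield L)) (Fin n)),
      Mω (piSchwartzBruhatEquiv (↥(maximalRealSubfield L)) (Fin n) (Φ ⊗ₜ f)) =
        piSchwartzBruhatEquiv (↥(maximalRealSubfield L)) (Fin n) (A Φ ⊗ₜ Mf f))
    {f₀ : FinSB (↥(maximalRealSubfield L)) (Fin n)} (hf₀ : Mf f₀ ≠ 0)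
    (P : (Fin n → mixedEmbedding.mixedSpace (↥(maximalRealSubfield L))) ≃L[ℝ]
      (Fin n → mixedEmbedding.mixedSpace (↥(maximalRealSubfield L))))
    (Q : (Fin n → mixedEmbedding.mixedSpace (↥(maximalRealSubfield L))) →
      (Fin n → mixedEmbedding.mixedSpace (↥(maximalRealSubfield L))))
    (hP : ∀ a w, (archAct (adelicGram (↥(maximalRealSubfield L)) e (realDiagonal L dV hdV) (realDiagonal L dW hdW))
      ((archPairSp L e dV hdV dW hdW u)⁻¹ * h₀) (a, w)).1 = P a)
    (hQ : ∀ a w, (archAct (adelicGram (↥(maximalRealSubfield L)) e (realDiagonal L dV hdV) (realDiagonal L dW hdW))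
      ((archPairSp L e dV hdV dW hdW u)⁻¹ * h₀) (a, w)).2 = Q w)
    {Φ₀ : 𝓢((Fin n → mixedEmbedding.mixedSpace (↥(maximalRealSubfield L))), ℂ)} (hΦ₀ : A Φ₀ ≠ 0) :
    ∃ c : ℂ, c ≠ 0 ∧ ∀ Φ : 𝓢((Fin n → mixedEmbedding.mixedSpace (↥(maximalRealSubfield L))), ℂ),
      A Φ = c • cmArchWeilRep L e dV hdV hdV0 dW hdW hdW0 hGR u (compCLE P Φ) := by
  obtain ⟨c, hc⟩ := exists_archFactor_eq_smul_cmArchWeilRep_compCLE L e dV hdV hdV0 dW hdW hdW0 hGR u h₀ Mω hM A Mf hAM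
    hf₀ P Q hP hQ
  refine ⟨c, fun h0 => hΦ₀ ?_, hc⟩
  rw [hc, h0, zero_smul]

end CMPin

end HodgeCM.Model.ArchLevi

end
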